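/-
Origin: expansion seat `prover-pub-hodgecm-mc-binder-1-g18-0`, handover #R123 2026-08-20T23:58:36Z md5 856398234f0b (466 l.; NEW additive MODEL leaf, ns HodgeCM.Model.TensorFamily ∕ HodgeCM.Model ∕ HodgeCM.Model.ThetaAdelicSide.ThetaDistDatum; imports PKG HodgeCM.Model.AdelicThetaDistributionSat (#1247, RUN 65) ONLY; independent of every RUN-66/67 row (install anywhere; DROP-ALONE); 0 records, 0 `def … : Prop`, one data def (`admFamilies`, a Submodule), nothing cited; the (J4-mult1) input is a HYPOTHESIS (`hmult` family form ∕ `hrk : Module.rank ℂ ↥(D.admFamilies ωar) ≤ 1` rank form) of the theorems that use it, never a field or a record; NAMES for audit: HodgeCM.Model.ThetaAdelicSide.ThetaDistDatum.exists_fam_eq_of_multOne · HodgeCM.Model.ThetaAdelicSide.ThetaDistDatum.adelicThetaSpanSat_eq_span_dist · HodgeCM.Model.ThetaAdelicSide.ThetaDistDatum.exists_eq_dist_of_mem_holSat; NAME LIST: HodgeCM.Model.ThetaAdelicSide.ThetaDistDatum.exists_fam_eq_of_multOne · HodgeCM.Model.ThetaAdelicSide.ThetaDistDatum.adelicThetaSpanSat_eq_span_dist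 · HodgeCM.Model.ThetaAdelicSide.ThetaDistDatum.exists_eq_dist_of_mem_holSat; all decls: HodgeCM.Model.TensorFamily.equivFinsuppOfBasisRight_map_id · HodgeCM.Model.TensorFamily.tmul_left_cancel_of_ne_zero · HodgeCM.Model.TensorFamily.tmul_right_cancel_of_ne_zero · HodgeCM.Model.TensorFamily.exists_forall_eq_tmul · HodgeCM.Model.TensorFamily.exists_forall_eq_tmul_fixed · HodgeCM.Model.regimeEquiv_archToAdelic_mem_satLevelRegimeOf · HodgeCM.Model.ThetaAdelicSide.ThetaDistDatum.admFamilies (def, Submodule) · HodgeCM.Model.ThetaAdelicSide.ThetaDistDatum.mem_admFamilies_iff · HodgeCM.Model.ThetaAdelicSide.ThetaDistDatum.adelicTensorEnd_apply_piSchwartzBruhatEquiv · HodgeCM.Model.ThetaAdelicSide.ThetaDistDatum.finSB_indicatorSB_top_ne_zero · HodgeCM.Model.ThetaAdelicSide.ThetaDistDatum.Φarch_mem_admFamilies · HodgeCM.Model.ThetaAdelicSide.ThetaDistDatum.multOne_of_rank_le_one · HodgeCM.Model.ThetaAdelicSide.ThetaDistDatum.exists_fam_eq_of_multOne · HodgeCM.Model.ThetaAdelicSide.ThetaDistDatum.coe_thetaForm_eq_dist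 · HodgeCM.Model.ThetaAdelicSide.ThetaDistDatum.exists_coe_thetaForm_eq_dist_of_multOne · HodgeCM.Model.ThetaAdelicSide.ThetaDistDatum.adelicThetaSpanSat_le_span_dist · HodgeCM.Model.ThetaAdelicSide.ThetaDistDatum.adelicThetaSpanSat_eq_span_dist · HodgeCM.Model.ThetaAdelicSide.ThetaDistDatum.exists_eq_dist_of_mem_adelicThetaSpanSat · HodgeCM.Model.ThetaAdelicSide.ThetaDistDatum.exists_eq_dist_of_mem_holSat) (`HOME/mc/pub-hodgecm-mc-binder-1-g18/stage67/HodgeCM/Model/AdelicThetaDistributionMult.lean`, md5 856398234f0b, 466 lines);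
landed by the gen-28 packager (p-g28) in gate run 67 as `HodgeCM/Model/AdelicThetaDistributionMult.lean` (verbatim).
-/
/-
Copyright (c) 2026 the pub-hodgecm formalisation cell (harness21).  New file, not vendored.
Origin: session prover-pub-hodgecm-mc-binder-1-g18-0 (unit pub-hodgecm-mc-binder-1-g18, BINDER PROVER gen 18; the (J4-mult1) ALGEBRA leaf of
the (J-Liu-Θ) junction behind E's row 9 `hΘ`: modulo multiplicity one of the archimedean `K_∞`-type, the test families of EVERY strict
saturated `K`-type situation of a slot are the product families `Φarch(·) ⊗ Φ_f` of the slot's product Weil datum), 2026-08-20.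
Intended final place: `HodgeCM/Model/AdelicThetaDistributionMult.lean` (NEW additive model-layer leaf; imports sinst-1's
`HodgeCM.Model.AdelicThetaDistributionSat` (#1247) only; nothing imports it; drop alone).
-/
import Summits.HodgeConjecture.HodgeCM.Model.AdelicThetaDistributionSat_2

set_option autoImplicit false

/-!
# Product families from multiplicity one: every saturated theta form of the slot is a value of the distribution

For an adelic side `S : ThetaAdelicSide V c` (regime `hV`), a slot `k` and a product Weil datum `D : S.ThetaDistDatum hV k`
(`Model/AdelicThetaDistribution`), the model's theta space is fed by ALL strict `K`-type situations saturated at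
`satG hV K = Π_{w ≠ w(ι₁)} U(V)(L⁺_w) × K` (`adelicThetaSpanSat`, #1238), whose test families `ℓ ↦ j (ι ℓ) ∈ 𝒮(𝔸³)` are ARBITRARY
`K_∞`-type-`τ₁^∨` vectors, while the distribution `D.dist f : Φ_f ↦ θ(Φarch(·) ⊗ Φ_f, f)` only reaches the product families of the
STANDARD archimedean family `Φarch`.  This file closes the gap MODULO ONE archimedean statement, multiplicity one of the `K_∞`-type:

* § 0 (linear algebra, any field) **`TensorFamily.exists_forall_eq_tmul`** — PRODUCT FAMILIES FROM MULTIPLICITY ONE: if every linear family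
  `a : X → M` intertwining operators `T_j` on `M` with operators `σ_j` on `X` is a scalar multiple of one family `Φ`, then every linear
  family `b : X → M ⊗ N` intertwining `T_j ⊗ 1` with `σ_j` is `x ↦ Φ x ⊗ n` for ONE vector `n ∈ N` (expand along a basis of `N`:
  `TensorProduct.equivFinsuppOfBasisRight`; every coordinate family is admissible, hence `c_i • Φ`; `n := Σ c_i 𝒞_i` over the finite
  support); `tmul_right_cancel_of_ne_zero`;
* § 1 `regimeEquiv_archToAdelic_mem_satLevelRegimeOf` — the compact archimedean factors AWAY from `ι₁` lie in every saturation group, so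
  (E2) `IsStrict.act_family_eq_self` makes the test vectors of a saturated strict situation FIXED by them (this, not a torus-weight
  condition, pins the components at the places `w ≠ w(ι₁)`);
* § 2 the archimedean operator datum `ωar` / `har : (S.P k).ω ((aa)^𝔸_regime, 1) = ωar aa ⊗ 1` for `aa` away from `ι₁` (at `archSideOf …`:
  `ωar aa = cₖ(aa′) • ω_∞(aa′, 1)`, carch `lineRepOf_k_regime_archToAdelicG`), the ℂ-space **`D.admFamilies ωar`** of ADMISSIBLE archimedean
  families `a : W^∨ →ₗ 𝓢((L⁺ ⊗ ℝ)³)` (`K_∞`-type `τ₁^∨` under `D.ωA` on `Stab(x₀)`, values fixed by every `ωar aa`), `Φarch_mem_admFamilies`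
  (`harm` + `hdef`), and the two forms of the (J4-mult1) input: FAMILY form `∀ a ∈ admFamilies, ∃ r, a = r • D.Φarch`, implied
  (`multOne_of_rank_le_one`) by the RANK form **`Module.rank ℂ ↥(D.admFamilies ωar) ≤ 1`** (multiplicity at most one of the `K_∞`-type
  «`τ₁^∨` at `ι₁`, trivial away from `ι₁`» in the slot's archimedean Weil representation — Howe 1989 (3.13) pp. 542–543 read place by
  place: at `ι₁` the compact see-saw partner `M′(1,1)` of `K₁ = U(2) × U(1)` is a torus, so every `K₁`-type occurs once; at `w ≠ ι₁` a
  `U(3)_w`-eigenline of a character in the Fock space is the vacuum line or `0`) together with `D.Φarch ≠ 0`;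
* § 3 **`exists_fam_eq_of_multOne`**: for EVERY strict situation `Sit` (any level) saturated at `satG hV K` and every `j ∈ Sit.𝓙` there is ONE
  `K`-fixed finite test vector `Φ_f` with `j (ι ℓ) = Φarch ℓ ⊗ Φ_f` for all `ℓ`; hence (`coe_thetaForm_eq_dist`) the theta form of `(Sit, j, f)`
  IS `D.dist f Φ_f` as a function on `G_U(𝔸)` for EVERY weight function `f`, and **`adelicThetaSpanSat_le_span_dist`**: the `satG hV K`-saturated
  adèlic theta module of the slot is spanned by the values `D.dist f Φ_f`, `f ∈ 𝓕`, `Φ_f` `K`-fixed (`= ` the theta forms of the product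
  situation `D.sitOf K hK`, `adelicThetaSpanSat_eq_span_dist`, with #1247 `dist_mem_adelicThetaSpanSat`).
With sinst-1's #1248 `clsU_distU_mem_block` / #1251 this places the tower class of EVERY theta form of the slot (not only the product-type
ones) in the block of Liu's module `Ω(χ)` — `hfam` clause 2 in full, modulo the named multiplicity-one input.
KERNEL only: one `Submodule` definition, 0 records, 0 `def … : Prop`, nothing cited as a sentence; the multiplicity-one input is a
HYPOTHESIS of the theorems that use it; `#print axioms` ⊆ {propext, Classical.choice, Quot.sound}.
-/

noncomputable section

open MeasureTheory MulAction IsDedekindDomain NumberField.mixedEmbedding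
open NumberField hiding relNormOneIdeles relNormOneRat probHaarRelNormOneQuot
open Literature.NumberTheory.Automorphic Literature.NumberTheory.Weil1964
open Literature.NumberTheory.Automorphic.UnitaryGroup
open Literature.Geometry.ComplexHyperbolic.BallModel (U21 x₀)
open Literature.AlgebraicGeometry.HodgeTheory Literature.AlgebraicGeometry.ShimuraVarieties
open Literature.NumberTheory.Automorphic.PicardCM
open HodgeCM.Model.SupplyInstance HodgeCM.Model.SupplyResidual HodgeCM.Model.ThetaSpace
open scoped SchwartzMap TensorProduct Classical

namespace HodgeCM
namespace Model

/-! ### § 0. Product families from multiplicity one (linear algebra over a field) -/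

namespace TensorFamily

variable {𝕜 : Type*} [Field 𝕜] {M N X : Type*} [AddCommGroup M] [Module 𝕜 M] [AddCommGroup N] [Module 𝕜 N]
  [AddCommGroup X] [Module 𝕜 X]

/-- Coordinates along a basis of the right factor commute with operators on the left factor. -/
theorem equivFinsuppOfBasisRight_map_id {κ : Type*} (𝒞 : Module.Basis κ 𝕜 N) (T : M →ₗ[𝕜] M) (x : M ⊗[𝕜] N) (i : κ) :
    TensorProduct.equivFinsuppOfBasisRight 𝒞 (TensorProduct.map T LinearMap.id x) i =
      T (TensorProduct.equivFinsuppOfBasisRight 𝒞 x i) := by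
  induction x using TensorProduct.induction_on with
  | zero => rw [map_zero, map_zero, Finsupp.zero_apply, map_zero]
  | tmul m n =>
    rw [TensorProduct.map_tmul, LinearMap.id_apply, TensorProduct.equivFinsuppOfBasisRight_apply_tmul_apply,
      TensorProduct.equivFinsuppOfBasisRight_apply_tmul_apply, map_smul]
  | add x y hx hy => rw [map_add, map_add, Finsupp.add_apply, hx, hy, map_add, Finsupp.add_apply, map_add]

/-- `m ⊗ n = m' ⊗ n` with `n ≠ 0` forces `m = m'`. -/
theorem tmul_left_cancel_of_ne_zero {n : N} (hn : n ≠ 0) {m m' : M} (h : m ⊗ₜ[𝕜] n = m' ⊗ₜ[𝕜] n) : m = m' := by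
  let 𝒞 := Module.Free.chooseBasis 𝕜 N
  obtain ⟨i, hi⟩ : ∃ i, 𝒞.repr n i ≠ 0 := by
    by_contra hcon
    push Not at hcon
    exact hn (𝒞.repr.map_eq_zero_iff.mp (Finsupp.ext hcon))
  have h1 := congrArg (fun x => TensorProduct.equivFinsuppOfBasisRight (M := M) 𝒞 x i) h
  simp only [TensorProduct.equivFinsuppOfBasisRight_apply_tmul_apply] at h1
  exact smul_right_injective M hi h1

/-- `m ⊗ n = m ⊗ n'` with `m ≠ 0` forces `n = n'`. -/
theorem tmul_right_cancel_of_ne_zero {m : M} (hm : m ≠ 0) {n n' : N} (h : m ⊗ₜ[𝕜] n = m ⊗ₜ[𝕜] n') : n = n' := by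
  let ℬ := Module.Free.chooseBasis 𝕜 M
  obtain ⟨i, hi⟩ : ∃ i, ℬ.repr m i ≠ 0 := by
    by_contra hcon
    push Not at hcon
    exact hm (ℬ.repr.map_eq_zero_iff.mp (Finsupp.ext hcon))
  have h1 := congrArg (fun x => TensorProduct.equivFinsuppOfBasisLeft (N := N) ℬ x i) h
  simp only [TensorProduct.equivFinsuppOfBasisLeft_apply_tmul_apply] at h1
  exact smul_right_injective N hi h1

/-- **Product families from multiplicity one.**  Let operators `T j` on `M` and `σ j` on `X` be given (`j : J`).  If every linear family
`a : X →ₗ M` with `T j (a x) = a (σ j x)` is a scalar multiple of the family `Φ`, then every linear family `b : X →ₗ M ⊗ N` with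
`(T j ⊗ 1) (b x) = b (σ j x)` is `x ↦ Φ x ⊗ n` for ONE vector `n : N`. -/
theorem exists_forall_eq_tmul {J : Type*} (T : J → (M →ₗ[𝕜] M)) (σ : J → (X →ₗ[𝕜] X)) (Φ : X →ₗ[𝕜] M)
    (hmult : ∀ a : X →ₗ[𝕜] M, (∀ j x, T j (a x) = a (σ j x)) → ∃ r : 𝕜, a = r • Φ)
    (b : X →ₗ[𝕜] M ⊗[𝕜] N) (hb : ∀ j x, TensorProduct.map (T j) LinearMap.id (b x) = b (σ j x)) :
    ∃ n : N, ∀ x, b x = Φ x ⊗ₜ[𝕜] n := by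
  let 𝒞 := Module.Free.chooseBasis 𝕜 N
  let e := TensorProduct.equivFinsuppOfBasisRight (M := M) 𝒞
  let a : Module.Free.ChooseBasisIndex 𝕜 N → (X →ₗ[𝕜] M) := fun i => (Finsupp.lapply i) ∘ₗ e.toLinearMap ∘ₗ b
  have ha_apply : ∀ i x, a i x = e (b x) i := fun i x => rfl
  have ha : ∀ i j x, T j (a i x) = a i (σ j x) := fun i j x => by
    rw [ha_apply, ha_apply, ← hb, equivFinsuppOfBasisRight_map_id]
  choose r hr using fun i => hmult (a i) (ha i)
  have hci : ∀ i x, e (b x) i = r i • Φ x := fun i x => by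
    rw [← ha_apply, hr i, LinearMap.smul_apply]
  by_cases hΦ : ∀ x, Φ x = 0
  · refine ⟨0, fun x => ?_⟩
    have h0 : e (b x) = 0 := Finsupp.ext fun i => by rw [hci, hΦ, smul_zero, Finsupp.zero_apply]
    rw [hΦ, TensorProduct.zero_tmul]
    exact e.map_eq_zero_iff.mp h0
  · push Not at hΦ
    obtain ⟨x₀, hx₀⟩ := hΦ
    refine ⟨∑ i ∈ (e (b x₀)).support, r i • 𝒞 i, fun x => e.injective (Finsupp.ext fun i => ?_)⟩
    have hrepr : 𝒞.repr (∑ i' ∈ (e (b x₀)).support, r i' • 𝒞 i') i = if i ∈ (e (b x₀)).support then r i else 0 := by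
      rw [map_sum, Finsupp.finsetSum_apply]
      simp_rw [map_smul, Module.Basis.repr_self, Finsupp.smul_apply, Finsupp.single_apply, smul_eq_mul, mul_ite, mul_one,
        mul_zero]
      rw [Finset.sum_ite_eq']
    rw [hci, TensorProduct.equivFinsuppOfBasisRight_apply_tmul_apply, hrepr]
    by_cases hi : i ∈ (e (b x₀)).support
    · rw [if_pos hi]
    · rw [if_neg hi, zero_smul]
      have h0 : r i • Φ x₀ = 0 := by rw [← hci]; exact Finsupp.notMem_support_iff.mp hi
      rw [(smul_eq_zero.mp h0).resolve_right hx₀, zero_smul]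

/-- The same with, in addition, operators `R l` on the right factor FIXING `b` (`(1 ⊗ R l) (b x) = b x`): the vector `n` may be chosen
fixed by every `R l`. -/
theorem exists_forall_eq_tmul_fixed {J Λ : Type*} (T : J → (M →ₗ[𝕜] M)) (σ : J → (X →ₗ[𝕜] X)) (Φ : X →ₗ[𝕜] M)
    (hmult : ∀ a : X →ₗ[𝕜] M, (∀ j x, T j (a x) = a (σ j x)) → ∃ r : 𝕜, a = r • Φ)
    (R : Λ → (N →ₗ[𝕜] N))
    (b : X →ₗ[𝕜] M ⊗[𝕜] N) (hb : ∀ j x, TensorProduct.map (T j) LinearMap.id (b x) = b (σ j x))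
    (hR : ∀ l x, TensorProduct.map LinearMap.id (R l) (b x) = b x) :
    ∃ n : N, (∀ l, R l n = n) ∧ ∀ x, b x = Φ x ⊗ₜ[𝕜] n := by
  obtain ⟨n, hn⟩ := exists_forall_eq_tmul T σ Φ hmult b hb
  by_cases hΦ : ∀ x, Φ x = 0
  · exact ⟨0, fun l => (R l).map_zero, fun x => by rw [hn, hΦ, TensorProduct.zero_tmul, TensorProduct.zero_tmul]⟩
  · push Not at hΦ
    obtain ⟨x₀, hx₀⟩ := hΦ
    refine ⟨n, fun l => ?_, hn⟩
    have h := hR l x₀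
    rw [hn, TensorProduct.map_tmul, LinearMap.id_apply] at h
    exact tmul_right_cancel_of_ne_zero hx₀ h

end TensorFamily

/-! ### § 1. Archimedean elements away from `ι₁` lie in every saturation group -/

section Away

variable {L : CMField} {ι₁ : L →+* ℂ} (V : HermSpace3 L ι₁) (hV : IsAnisotropic L V.Hm)

/-- **An archimedean element with trivial `w(ι₁)`-component lies in `satLevelRegimeOf V hV K` for EVERY finite level `K`** (its finite part
is `1 ∈ K`, tree `archToAdelic_mem_awayFrom_iff` / `finPart_archToAdelic`). -/
theorem regimeEquiv_archToAdelic_mem_satLevelRegimeOf (K : Subgroup ↥V.adelicFin)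
    {aa : UnitaryGroup.arch (↥(maximalRealSubfield L)) L (IsCMField.complexConj L) 3 V.Hm}
    (haa : UnitaryGroup.archAt (↥(maximalRealSubfield L)) L (IsCMField.complexConj L) 3 V.Hm (UnitaryGroup.cmPlace (L : Type) ι₁)
        (NumberField.complexConj_smul_infinitePlace (L : Type) _) (IsCMField.complexConj_ne_one (L : Type)) aa = 1) :
    HodgeCM.Adelic.regimeEquiv L V.Hm hV
        (UnitaryGroup.archToAdelic (↥(maximalRealSubfield L)) L (IsCMField.complexConj L) 3 V.Hm aa) ∈ satLevelRegimeOf V hV K := by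
  refine mem_satLevelRegimeOf_of_mem V hV K ?_
  rw [← awayLevelCM_eq_satLevelOf]
  refine (UnitaryGroup.mem_awayLevelCM_iff _ _ _ _ _ _).2 ⟨?_, ?_⟩
  · exact (archToAdelic_mem_awayFrom_iff (↥(maximalRealSubfield L)) (L : Type) (IsCMField.complexConj L) 3 V.Hm
      (IsCMField.complexConj_ne_one (L : Type)) (NumberField.complexConj_smul_infinitePlace (L : Type))
      (UnitaryGroup.cmPlace (L : Type) ι₁) aa).2 haa
  · rw [finPart_archToAdelic]
    exact K.one_mem

end Away

namespace ThetaAdelicSide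
namespace ThetaDistDatum

variable {L : CMField} {ι₁ : L →+* ℂ} {V : HermSpace3 L ι₁} {c : SeesawCtx L}
variable {S : ThetaAdelicSide V c} {hV : IsAnisotropic L V.Hm} {k : Fin 4} (D : S.ThetaDistDatum hV k)

/-! ### § 2. Admissible archimedean families and the multiplicity-one input -/

section Adm

variable (ωar : UnitaryGroup.arch (↥(maximalRealSubfield L)) L (IsCMField.complexConj L) 3 V.Hm →
    (𝓢((Fin 3 → mixedSpace (↥(maximalRealSubfield L))), ℂ) →ₗ[ℂ] 𝓢((Fin 3 → mixedSpace (↥(maximalRealSubfield L))), ℂ)))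

/-- **The ℂ-space of ADMISSIBLE ARCHIMEDEAN FAMILIES of the slot** relative to the archimedean operators `ωar`: the linear families
`a : W^∨ → 𝓢((L⁺ ⊗ ℝ)³)` of `K_∞`-type `τ₁^∨` under `D.ωA` on `Stab(x₀)` (as `D.harm` for `D.Φarch`) whose values are fixed by `ωar aa` for
every archimedean `aa ∈ U(V)(L ⊗ ℝ)` with trivial `w(ι₁)`-component. -/
def admFamilies : Submodule ℂ (Module.Dual ℂ (Fin 2 → ℂ) →ₗ[ℂ] 𝓢((Fin 3 → mixedSpace (↥(maximalRealSubfield L))), ℂ)) where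
  carrier := {a | (∀ (u : ↥(stabilizer U21 x₀)) (ℓ : Module.Dual ℂ (Fin 2 → ℂ)),
      D.ωA (u : U21) (a ℓ) = a ((BallForms.isPullbackCocycle_cotangentCocycle.weightOf x₀).dual u ℓ)) ∧
    ∀ aa : UnitaryGroup.arch (↥(maximalRealSubfield L)) L (IsCMField.complexConj L) 3 V.Hm,
      UnitaryGroup.archAt (↥(maximalRealSubfield L)) L (IsCMField.complexConj L) 3 V.Hm (UnitaryGroup.cmPlace (L : Type) ι₁)
          (NumberField.complexConj_smul_infinitePlace (L : Type) _) (IsCMField.complexConj_ne_one (L : Type)) aa = 1 →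
      ∀ ℓ : Module.Dual ℂ (Fin 2 → ℂ), ωar aa (a ℓ) = a ℓ}
  add_mem' := by
    rintro a b ⟨ha₁, ha₂⟩ ⟨hb₁, hb₂⟩
    exact ⟨fun u ℓ => by rw [LinearMap.add_apply, LinearMap.add_apply, map_add, ha₁, hb₁],
      fun aa haa ℓ => by rw [LinearMap.add_apply, map_add, ha₂ aa haa, hb₂ aa haa]⟩
  zero_mem' := ⟨fun u ℓ => by rw [LinearMap.zero_apply, LinearMap.zero_apply, map_zero],
    fun aa _ ℓ => by rw [LinearMap.zero_apply, map_zero]⟩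
  smul_mem' := by
    rintro r a ⟨ha₁, ha₂⟩
    exact ⟨fun u ℓ => by rw [LinearMap.smul_apply, LinearMap.smul_apply, map_smul, ha₁],
      fun aa haa ℓ => by rw [LinearMap.smul_apply, map_smul, ha₂ aa haa]⟩

/-- (Ported verbatim from the HodgeCMPerL package; no docstring in the source.) -/
theorem mem_admFamilies_iff {a : Module.Dual ℂ (Fin 2 → ℂ) →ₗ[ℂ] 𝓢((Fin 3 → mixedSpace (↥(maximalRealSubfield L))), ℂ)} :
    a ∈ D.admFamilies ωar ↔
      (∀ (u : ↥(stabilizer U21 x₀)) (ℓ : Module.Dual ℂ (Fin 2 → ℂ)),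
          D.ωA (u : U21) (a ℓ) = a ((BallForms.isPullbackCocycle_cotangentCocycle.weightOf x₀).dual u ℓ)) ∧
        ∀ aa : UnitaryGroup.arch (↥(maximalRealSubfield L)) L (IsCMField.complexConj L) 3 V.Hm,
          UnitaryGroup.archAt (↥(maximalRealSubfield L)) L (IsCMField.complexConj L) 3 V.Hm (UnitaryGroup.cmPlace (L : Type) ι₁)
              (NumberField.complexConj_smul_infinitePlace (L : Type) _) (IsCMField.complexConj_ne_one (L : Type)) aa = 1 →
          ∀ ℓ : Module.Dual ℂ (Fin 2 → ℂ), ωar aa (a ℓ) = a ℓ :=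
  Iff.rfl

/-- `adelicTensorEnd A B` acts on `piSchwartzBruhatEquiv x` as `TensorProduct.map A B` acts on `x`. -/
theorem adelicTensorEnd_apply_piSchwartzBruhatEquiv
    (A : 𝓢((Fin 3 → mixedSpace (↥(maximalRealSubfield L))), ℂ) →ₗ[ℂ] 𝓢((Fin 3 → mixedSpace (↥(maximalRealSubfield L))), ℂ))
    (B : FinSB (↥(maximalRealSubfield L)) (Fin 3) →ₗ[ℂ] FinSB (↥(maximalRealSubfield L)) (Fin 3))
    (x : 𝓢((Fin 3 → mixedSpace (↥(maximalRealSubfield L))), ℂ) ⊗[ℂ] FinSB (↥(maximalRealSubfield L)) (Fin 3)) :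
    adelicTensorEnd A B (piSchwartzBruhatEquiv (↥(maximalRealSubfield L)) (Fin 3) x) =
      piSchwartzBruhatEquiv (↥(maximalRealSubfield L)) (Fin 3) (TensorProduct.map A B x) := by
  simp only [adelicTensorEnd, LinearMap.comp_apply, LinearEquiv.coe_toLinearMap, LinearEquiv.symm_apply_apply]

/-- A nonzero finite test vector: the indicator of the integral box `𝒪̂³`. -/
theorem finSB_indicatorSB_top_ne_zero :
    indicatorSB (↥(maximalRealSubfield L)) (Fin 3) (piLevelIdeal (↥(maximalRealSubfield L)) (Fin 3) ⊤)
        (isOpen_piLevelIdeal (↥(maximalRealSubfield L)) ⊤) (isCompact_piLevelIdeal (↥(maximalRealSubfield L)) (Fin 3) ⊤) ≠ 0 := by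
  intro h
  have h0 := congrArg (fun Φ : FinSB (↥(maximalRealSubfield L)) (Fin 3) => (Φ : (Fin 3 → FiniteAdeleRing (𝓞 ↥(maximalRealSubfield L))
    ↥(maximalRealSubfield L)) → ℂ) 0) h
  simp only [coe_indicatorSB, ZeroMemClass.coe_zero, Pi.zero_apply,
    Set.indicator_of_mem (SetLike.mem_coe.2 (AddSubgroup.zero_mem _)), one_ne_zero] at h0

/-- **The standard family is admissible**: `K_∞`-type by `D.harm`; fixed away from `ι₁` by `D.hdef` read through `har` against a nonzero
finite vector. -/
theorem Φarch_mem_admFamilies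
    (har : ∀ aa : UnitaryGroup.arch (↥(maximalRealSubfield L)) L (IsCMField.complexConj L) 3 V.Hm,
      UnitaryGroup.archAt (↥(maximalRealSubfield L)) L (IsCMField.complexConj L) 3 V.Hm (UnitaryGroup.cmPlace (L : Type) ι₁)
          (NumberField.complexConj_smul_infinitePlace (L : Type) _) (IsCMField.complexConj_ne_one (L : Type)) aa = 1 →
      (S.P k).ω (HodgeCM.Adelic.regimeEquiv L V.Hm hV
          (UnitaryGroup.archToAdelic (↥(maximalRealSubfield L)) L (IsCMField.complexConj L) 3 V.Hm aa), 1) =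
        adelicTensorEnd (K := ↥(maximalRealSubfield L)) (ι := Fin 3) (ωar aa) LinearMap.id) :
    D.Φarch ∈ D.admFamilies ωar := by
  refine ⟨fun u ℓ => D.harm u ℓ, fun aa haa ℓ => ?_⟩
  have h := D.hdef aa haa ℓ (indicatorSB (↥(maximalRealSubfield L)) (Fin 3) (piLevelIdeal (↥(maximalRealSubfield L)) (Fin 3) ⊤)
    (isOpen_piLevelIdeal (↥(maximalRealSubfield L)) ⊤) (isCompact_piLevelIdeal (↥(maximalRealSubfield L)) (Fin 3) ⊤))
  rw [har aa haa, adelicTensorEnd_apply_tmul, LinearMap.id_apply] at h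
  exact TensorFamily.tmul_left_cancel_of_ne_zero finSB_indicatorSB_top_ne_zero ((piSchwartzBruhatEquiv (↥(maximalRealSubfield L)) (Fin 3)).injective h)

/-- **The FAMILY form of the multiplicity-one input from the RANK form**: if the admissible families have `ℂ`-rank at most one and the
standard family `D.Φarch` is nonzero, every admissible family is a scalar multiple of `D.Φarch`. -/
theorem multOne_of_rank_le_one
    (har : ∀ aa : UnitaryGroup.arch (↥(maximalRealSubfield L)) L (IsCMField.complexConj L) 3 V.Hm,
      UnitaryGroup.archAt (↥(maximalRealSubfield L)) L (IsCMField.complexConj L) 3 V.Hm (UnitaryGroup.cmPlace (L : Type) ι₁)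
          (NumberField.complexConj_smul_infinitePlace (L : Type) _) (IsCMField.complexConj_ne_one (L : Type)) aa = 1 →
      (S.P k).ω (HodgeCM.Adelic.regimeEquiv L V.Hm hV
          (UnitaryGroup.archToAdelic (↥(maximalRealSubfield L)) L (IsCMField.complexConj L) 3 V.Hm aa), 1) =
        adelicTensorEnd (K := ↥(maximalRealSubfield L)) (ι := Fin 3) (ωar aa) LinearMap.id)
    (hΦ : D.Φarch ≠ 0) (hrk : Module.rank ℂ ↥(D.admFamilies ωar) ≤ 1) :
    ∀ a ∈ D.admFamilies ωar, ∃ r : ℂ, a = r • D.Φarch := by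
  obtain ⟨v₀, -, hle⟩ := (rank_submodule_le_one_iff _).1 hrk
  obtain ⟨t, ht⟩ := Submodule.mem_span_singleton.1 (hle (D.Φarch_mem_admFamilies ωar har))
  have ht0 : t ≠ 0 := by
    rintro rfl
    exact hΦ (by rw [← ht, zero_smul])
  intro a ha
  obtain ⟨r', hr'⟩ := Submodule.mem_span_singleton.1 (hle ha)
  refine ⟨r' * t⁻¹, ?_⟩
  rw [← hr', ← ht, smul_smul, mul_assoc, inv_mul_cancel₀ ht0, mul_one]

end Adm

/-! ### § 3. Every strict saturated situation's test families are product families -/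

section Main

variable (ωar : UnitaryGroup.arch (↥(maximalRealSubfield L)) L (IsCMField.complexConj L) 3 V.Hm →
    (𝓢((Fin 3 → mixedSpace (↥(maximalRealSubfield L))), ℂ) →ₗ[ℂ] 𝓢((Fin 3 → mixedSpace (↥(maximalRealSubfield L))), ℂ)))
  (har : ∀ aa : UnitaryGroup.arch (↥(maximalRealSubfield L)) L (IsCMField.complexConj L) 3 V.Hm,
      UnitaryGroup.archAt (↥(maximalRealSubfield L)) L (IsCMField.complexConj L) 3 V.Hm (UnitaryGroup.cmPlace (L : Type) ι₁)
          (NumberField.complexConj_smul_infinitePlace (L : Type) _) (IsCMField.complexConj_ne_one (L : Type)) aa = 1 →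
      (S.P k).ω (HodgeCM.Adelic.regimeEquiv L V.Hm hV
          (UnitaryGroup.archToAdelic (↥(maximalRealSubfield L)) L (IsCMField.complexConj L) 3 V.Hm aa), 1) =
        adelicTensorEnd (K := ↥(maximalRealSubfield L)) (ι := Fin 3) (ωar aa) LinearMap.id)
  (hmult : ∀ a ∈ D.admFamilies ωar, ∃ r : ℂ, a = r • D.Φarch)

include har hmult in
/-- **Every strict saturated situation's test families are product families of the datum** (modulo multiplicity one).  For a strict
`K`-type situation `Sit` of the slot (any level `Δ`) SATURATED at `satG hV K` and `j ∈ Sit.𝓙`, there is ONE finite test vector `Φ_f`, fixed by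
`K`, with `j (ι ℓ) = Φarch ℓ ⊗ Φ_f` for every covector `ℓ`: the family `ℓ ↦ j (ι ℓ) ∈ 𝓢_∞ ⊗ 𝒮(𝔸_f³)` intertwines `D.ωA u ⊗ 1` with `τ₁^∨ u`
((E3) + `D.hA`), is fixed by `ωar aa ⊗ 1` for `aa` away from `ι₁` ((E2) + § 1 + `har`) and by `1 ⊗ D.ωf (g, 1)` for `g ∈ K` ((E2) + `D.fin_V`),
so § 0 applies. -/
theorem exists_fam_eq_of_multOne (K : Subgroup ↥V.adelicFin) {Δ : Subgroup U21}
    (Sit : KTypeSituation (S.P k) S.ιinf Δ (stabilizer U21 x₀).subtype (BallForms.isPullbackCocycle_cotangentCocycle.weightOf x₀))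
    (hstr : Sit.IsStrict) (hsat : Sit.IsSaturated (satG hV K))
    {j : {j : Sit.E →ₗ[ℂ] (S.P k).weilDatum.ThetaTop // (S.P k).kernelDatum.IsThetaEquivariant Sit.κ Sit.σ j}} (hj : j ∈ Sit.𝓙) :
    ∃ Φf : FinSB (↥(maximalRealSubfield L)) (Fin 3), (∀ g ∈ K, D.ωf (g, 1) Φf = Φf) ∧ ∀ ℓ, j.1 (Sit.ι ℓ) = D.fam Φf ℓ := by
  let jι : Module.Dual ℂ (Fin 2 → ℂ) →ₗ[ℂ] ↥(piSchwartzBruhat (↥(maximalRealSubfield L)) (Fin 3)) := j.1 ∘ₗ Sit.ι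
  let b : Module.Dual ℂ (Fin 2 → ℂ) →ₗ[ℂ]
      𝓢((Fin 3 → mixedSpace (↥(maximalRealSubfield L))), ℂ) ⊗[ℂ] FinSB (↥(maximalRealSubfield L)) (Fin 3) :=
    (piSchwartzBruhatEquiv (↥(maximalRealSubfield L)) (Fin 3)).symm.toLinearMap ∘ₗ jι
  have hb_eq : ∀ ℓ, piSchwartzBruhatEquiv (↥(maximalRealSubfield L)) (Fin 3) (b ℓ) = j.1 (Sit.ι ℓ) := fun ℓ =>
    (piSchwartzBruhatEquiv (↥(maximalRealSubfield L)) (Fin 3)).apply_symm_apply _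
  -- (E3) + (W-⊗): the family intertwines `ωA u ⊗ 1` with `τ₁^∨ u`
  have hK₁ : ∀ (u : ↥(stabilizer U21 x₀)) (ℓ : Module.Dual ℂ (Fin 2 → ℂ)),
      TensorProduct.map (D.ωA (u : U21)) LinearMap.id (b ℓ) = b ((BallForms.isPullbackCocycle_cotangentCocycle.weightOf x₀).dual u ℓ) := by
    intro u ℓ
    apply (piSchwartzBruhatEquiv (↥(maximalRealSubfield L)) (Fin 3)).injective
    rw [← adelicTensorEnd_apply_piSchwartzBruhatEquiv, hb_eq, hb_eq, ← D.hA]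
    exact hstr.act_family_arch hj u ℓ
  -- (E2) + § 1 + `har`: the family is fixed by `ωar aa ⊗ 1` away from `ι₁`
  have haw : ∀ (aa : {aa : UnitaryGroup.arch (↥(maximalRealSubfield L)) L (IsCMField.complexConj L) 3 V.Hm //
      UnitaryGroup.archAt (↥(maximalRealSubfield L)) L (IsCMField.complexConj L) 3 V.Hm (UnitaryGroup.cmPlace (L : Type) ι₁)
          (NumberField.complexConj_smul_infinitePlace (L : Type) _) (IsCMField.complexConj_ne_one (L : Type)) aa = 1})
      (ℓ : Module.Dual ℂ (Fin 2 → ℂ)), TensorProduct.map (ωar aa.1) LinearMap.id (b ℓ) = b ℓ := by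
    intro aa ℓ
    apply (piSchwartzBruhatEquiv (↥(maximalRealSubfield L)) (Fin 3)).injective
    rw [← adelicTensorEnd_apply_piSchwartzBruhatEquiv, hb_eq, ← har aa.1 aa.2]
    exact hstr.act_family_eq_self hsat hj (regimeEquiv_archToAdelic_mem_satLevelRegimeOf V hV K aa.2) ℓ
  -- (E2) + (⊗-fin-V): the family is fixed by `1 ⊗ ωf (g, 1)`, `g ∈ K`
  have hKf : ∀ (g : ↥K) (ℓ : Module.Dual ℂ (Fin 2 → ℂ)),
      TensorProduct.map LinearMap.id (D.ωf ((g : ↥V.adelicFin), 1)) (b ℓ) = b ℓ := by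
    intro g ℓ
    apply (piSchwartzBruhatEquiv (↥(maximalRealSubfield L)) (Fin 3)).injective
    rw [← adelicTensorEnd_apply_piSchwartzBruhatEquiv, hb_eq, ← D.fin_V]
    exact hstr.act_family_eq_self hsat hj (finToG_mem_satLevelRegimeOf V hV g.2) ℓ
  obtain ⟨n, hnfix, hn⟩ := TensorFamily.exists_forall_eq_tmul_fixed
    (Sum.elim (fun u : ↥(stabilizer U21 x₀) => D.ωA (u : U21))
      (fun aa : {aa : UnitaryGroup.arch (↥(maximalRealSubfield L)) L (IsCMField.complexConj L) 3 V.Hm //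
        UnitaryGroup.archAt (↥(maximalRealSubfield L)) L (IsCMField.complexConj L) 3 V.Hm (UnitaryGroup.cmPlace (L : Type) ι₁)
          (NumberField.complexConj_smul_infinitePlace (L : Type) _) (IsCMField.complexConj_ne_one (L : Type)) aa = 1} => ωar aa.1))
    (Sum.elim (fun u : ↥(stabilizer U21 x₀) => (BallForms.isPullbackCocycle_cotangentCocycle.weightOf x₀).dual u)
      (fun _ => LinearMap.id))
    D.Φarch
    (fun a ha => hmult a ⟨fun u ℓ => ha (Sum.inl u) ℓ, fun aa haa ℓ => ha (Sum.inr ⟨aa, haa⟩) ℓ⟩)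
    (fun g : ↥K => D.ωf ((g : ↥V.adelicFin), 1)) b
    (fun jj ℓ => match jj with
      | Sum.inl u => hK₁ u ℓ
      | Sum.inr aa => haw aa ℓ)
    hKf
  refine ⟨n, fun g hg => hnfix ⟨g, hg⟩, fun ℓ => ?_⟩
  have h2 : piSchwartzBruhatEquiv (↥(maximalRealSubfield L)) (Fin 3) (b ℓ) =
      piSchwartzBruhatEquiv (↥(maximalRealSubfield L)) (Fin 3) (D.Φarch ℓ ⊗ₜ[ℂ] n) := by rw [hn]
  exact (hb_eq ℓ).symm.trans h2

omit ωar in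
/-- **The theta form of a situation whose family is a product family IS the distribution's value**, as a function on `G_U(𝔸)`, for
EVERY weight function `f`. -/
theorem coe_thetaForm_eq_dist {Δ : Subgroup U21}
    (Sit : KTypeSituation (S.P k) S.ιinf Δ (stabilizer U21 x₀).subtype (BallForms.isPullbackCocycle_cotangentCocycle.weightOf x₀))
    (j : {j : Sit.E →ₗ[ℂ] (S.P k).weilDatum.ThetaTop // (S.P k).kernelDatum.IsThetaEquivariant Sit.κ Sit.σ j})
    {Φf : FinSB (↥(maximalRealSubfield L)) (Fin 3)} (hfam : ∀ ℓ, j.1 (Sit.ι ℓ) = D.fam Φf ℓ)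
    (f : C(↥(relNormOneIdeles (↥(maximalRealSubfield L)) L) ⧸ relNormOneRat (↥(maximalRealSubfield L)) L, ℂ)) :
    (((S.P k).kernelDatum.thetaForm (probHaarRelNormOneQuot (↥(maximalRealSubfield L)) L) (S.P k).kernelDatum_thetaLinear
        Sit.κ j.1 j.2 Sit.ι Sit.hι f : weightForms (S.P k).ΓU Sit.κ Sit.τ) :
      (V.latticeModel printFact_unitaryCompact_holds).G → (Fin 2 → ℂ)) = D.dist f Φf := by
  funext g
  refine WeightForms.eq_of_forall_dual_eq (R := ℂ) fun ℓ => ?_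
  rw [ThetaKernelDatum.apply_thetaForm, apply_dist]
  exact congrArg (fun Φ => (S.P k).kernelDatum.thetaLiftFun (probHaarRelNormOneQuot (↥(maximalRealSubfield L)) L) Φ f g) (hfam ℓ)


-- port_pkg: scope closed for this part
end Main
end ThetaDistDatum
end ThetaAdelicSide
end Model
end HodgeCM
end
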